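import Summits.Ventures.Crystal3D.Theorems.StickyWulffConstantTextureLiminfCubeRigidityLocalHales
import Summits.Ventures.Crystal3D.Theorems.StickyWulffConstantTextureLiminfResolutionOfRigidity
import HarnessLib

/-!
# CUBE RIGIDITY PROVED — the geometric core of `stub_resolution`
# (lane T, crux `TextureLiminf`, stmt-Ventures-19483; registered line `TexShadow`, named core `CubeRigidity`)

HONEST FRAMING. Venture `Summits/Ventures/Crystal3D` (cell `crystal3d-full`), helper `--supports` the crux `TextureLiminf`
(stmt-Ventures-19483) of `route-Ventures-StickyWulffConstant`, registered line `TexShadow`.  Rung credit only; F-C1 not moved.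
This file DISCHARGES the named statement `CubeRigidity` of `…TexShadowResolutionDefs` (for every cube side `M ≥ 1` a margin `D`
such that in every finite packing of unit-diameter balls, a cube all of whose `D`-neighbourhood balls have close-packed first
shells has all its balls on ONE moved Barlow stacking), with `D = 336·M + 196`.  Together with the landed counting half
`barlowResolution_of_cubeRigidity : L12Local → CubeRigidity → BarlowResolution` (`…ResolutionOfRigidity`) and
`stub_l12Local` this closes `stub_resolution : L12Local → BarlowResolution` of the registered skeleton (by-name file separately).

PROOF (LOCAL Hales §1.3, bricks `…CubeRigidityLocalLayers/LayerSteps/LocalStacking/LocalHales`).  Fix a ball `a` in the cube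
(none: any stacking).  Every cube point is within `2M ≥ √3·M` of `a`.  CASE A — some ball `b` within `R₁ = 24M + 14` of `a` has an
HCP-type shell: in `b`'s HCP frame (`L2B.exists_hcp_frame`, doubled packing) the mirror layer propagates through the defect-free
ball, layer upon layer follows, and by local no-room every ball within `R₁ + 2M` of `b` — in particular every cube ball — is a
site of one close-packed stacking (`local_layerPackings_hcp`; arrangements needed within `312M + 182` of `b`, i.e. within
`D = 336M + 196` of `a`).  CASE B — no such `b`: every close-packed ball within `R₁` of `a` is FCC-type; in any FCC frame at `a`
(`exists_frame_of_isArrangedIn_fcc`) the FCC interlocking propagates the layer and `local_layerPackings_fcc` (all-FCC within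
`24M + 14 = R₁` of `a`) puts every ball within `2M` of `a` on one stacking.  Undo the frame: `x_c = L r + b` with
`2r ∈ barlowStacking 2 (2√(2/3)) s`, i.e. `x_c ∈ stacking L b s` (`mem_barlowStacking_one_iff`).

* **`cubeRigidity_holds : CubeRigidity`** (standard axioms; census-free).
* BY NAME for the skeleton (namespace `…Cruxes.TextureLiminf.TexShadow`): **`stub_cubeRigidity : CubeRigidity`** (v6.12's stub) and
  **`stub_resolution : L12Local → BarlowResolution`** (the registered stub of v6.3 / derived theorem of v6.12) `:=
  barlowResolution_of_cubeRigidity · stub_cubeRigidity`.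
WHAT THIS IS NOT: nothing about the other TexShadow stubs (`barlowAdhesionR`, `E1`, the bilayer wall parts, `textureBuild`);
F-C1 not moved.
-/

noncomputable section

namespace Summit.Ventures.Crystal3D.Theorems

open Literature.Geometry.DiscreteGeometry Literature.MathematicalPhysics.StatisticalMechanics
open RealInnerProductSpace Summit.Ventures.Crystal3D.L2B Summit.Ventures.Crystal3D.Theorems.LocalStacking
open Summit.Ventures.Crystal3D.Cruxes.TextureLiminf.TexShadow (stacking cube CubeRigidity)

variable {N : ℕ}

/-! ## Metric bookkeeping around a cube -/

/-- Two points of a half-open cube of side `M` are within `2M` of each other. -/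
theorem dist_le_two_mul_of_mem_cube {q p a : EuclideanSpace ℝ (Fin 3)} {M : ℝ} (hp : p ∈ cube q M) (ha : a ∈ cube q M) :
    dist p a ≤ 2 * M := by
  have hb : ∀ t : Fin 3, |p t - a t| ≤ M := fun t => by
    obtain ⟨h1, h2⟩ := hp t; obtain ⟨h3, h4⟩ := ha t
    exact abs_le.2 ⟨by linarith, by linarith⟩
  have hM : 0 ≤ M := (abs_nonneg _).trans (hb 0)
  have hsq : ∀ t : Fin 3, (p t - a t) ^ 2 ≤ M ^ 2 := fun t => by
    rw [← sq_abs]; exact pow_le_pow_left₀ (abs_nonneg _) (hb t) 2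
  have hd : dist p a ^ 2 ≤ (2 * M) ^ 2 := by rw [dist_sq_fin3]; nlinarith [hsq 0, hsq 1, hsq 2]
  nlinarith [hd, dist_nonneg (x := p) (y := a), hM]

/-- A ball within `r` of a point of the cube lies in the sup-norm `r`-neighbourhood of the cube. -/
theorem coord_bounds_of_dist_le {q a c : EuclideanSpace ℝ (Fin 3)} {M r : ℝ} (ha : a ∈ cube q M) (hc : dist c a ≤ r) :
    ∀ t : Fin 3, q t - r ≤ c t ∧ c t ≤ q t + M + r := by
  intro t
  have h := PiLp.norm_apply_le (c - a) t
  rw [Real.norm_eq_abs, ← dist_eq_norm] at h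
  have h' : |c t - a t| ≤ r := le_trans (by simpa using h) hc
  obtain ⟨h1, h2⟩ := abs_le.1 h'
  obtain ⟨h3, h4⟩ := ha t
  exact ⟨by linarith, by linarith⟩

/-- Doubled distances. -/
theorem norm_two_smul_sub_two_smul (p q : EuclideanSpace ℝ (Fin 3)) :
    ‖(2 : ℝ) • p - (2 : ℝ) • q‖ = 2 * dist p q := by
  rw [← smul_sub, norm_smul, Real.norm_of_nonneg zero_le_two, dist_eq_norm]

/-! ## From a local stacking in a frame to `stacking L b s` -/

/-- **Undoing the frame.** If, in the frame `y ↦ 2b + L y` of the doubled packing, every centre within `2ρ` of the origin is a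
point of `barlowStacking 2 (2√(2/3)) s`, then every ball of `x` within `ρ` of `b` lies on the moved stacking `stacking L b s`. -/
theorem mem_stacking_of_frame {x : Fin N → EuclideanSpace ℝ (Fin 3)} {b : EuclideanSpace ℝ (Fin 3)}
    {L : EuclideanSpace ℝ (Fin 3) ≃ₗᵢ[ℝ] EuclideanSpace ℝ (Fin 3)} {s : ℤ → ℤ} {ρ : ℝ}
    (hst : ∀ u ∈ {y | (2 : ℝ) • b + L y ∈ Set.range fun j => (2 : ℝ) • x j}, ‖u‖ ≤ 2 * ρ →
      u ∈ barlowStacking 2 layerSpacing s)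
    {c : Fin N} (hc : dist (x c) b ≤ ρ) : x c ∈ stacking L b s := by
  set u : EuclideanSpace ℝ (Fin 3) := L.symm ((2 : ℝ) • x c - (2 : ℝ) • b) with hu
  have huW : u ∈ {y | (2 : ℝ) • b + L y ∈ Set.range fun j => (2 : ℝ) • x j} := by
    refine ⟨c, ?_⟩
    simp only [hu, LinearIsometryEquiv.apply_symm_apply]; abel
  have hun : ‖u‖ ≤ 2 * ρ := by
    rw [hu, LinearIsometryEquiv.norm_map, norm_two_smul_sub_two_smul]; linarith
  have hmem := hst u huW hun
  refine ⟨L.symm (x c - b), ?_, by simp⟩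
  rw [mem_barlowStacking_one_iff]
  have e : (2 : ℝ) • L.symm (x c - b) = u := by rw [hu, ← map_smul, smul_sub]
  rw [e]; exact hmem

/-! ## The theorem -/

/-- **CUBE RIGIDITY holds** (`D = 336·M + 196`): in every finite packing of unit-diameter balls in `ℝ³`, a cube of side `M ≥ 1`
all of whose `D`-neighbourhood balls have close-packed (FCC- or HCP-type) first shells has all its balls on ONE moved Barlow
stacking.  Local Hales §1.3 in the frame of an HCP-type ball within `24M + 14` of the cube if there is one (its mirror layer
is the base layer), else in an FCC frame of a cube ball (all-FCC interlocking). -/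
theorem cubeRigidity_holds : CubeRigidity := by
  intro M hM
  refine ⟨336 * M + 196, by positivity, fun N x hx q hcp => ?_⟩
  -- an empty cube is on any stacking
  by_cases hne : ∃ i₀ : Fin N, x i₀ ∈ cube q M
  swap
  · refine ⟨LinearIsometryEquiv.refl ℝ _, 0, fun _ => 1, fun _ => Or.inl rfl, fun i hi => ?_⟩
    exact absurd ⟨i, hi⟩ hne
  obtain ⟨i₀, ha⟩ := hne
  set a := x i₀ with ha_def
  -- the doubled packing
  set V : Set (EuclideanSpace ℝ (Fin 3)) := Set.range fun j => (2 : ℝ) • x j with hVdef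
  have hV : IsUnitBallPacking V := isUnitBallPacking_range_two_smul hx
  -- close-packed shells near `a`, in Hales's vocabulary
  have cpNear : ∀ c : Fin N, dist (x c) a ≤ 336 * M + 196 →
      IsArrangedIn (kissingShell V ((2 : ℝ) • x c)) fccKissingPattern ∨
        IsArrangedIn (kissingShell V ((2 : ℝ) • x c)) hcpKissingPattern := by
    intro c hc
    rw [hVdef, kissingShell_range_two_smul]
    exact hcp c (coord_bounds_of_dist_le ha hc)
  -- shells in a frame `y ↦ 2b + L y`
  have frameShell : ∀ (b : EuclideanSpace ℝ (Fin 3)) (L : EuclideanSpace ℝ (Fin 3) ≃ₗᵢ[ℝ] EuclideanSpace ℝ (Fin 3))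
      (u : EuclideanSpace ℝ (Fin 3)), u ∈ {y | (2 : ℝ) • b + L y ∈ V} →
      ∃ c : Fin N, ‖u‖ = 2 * dist (x c) b ∧
        kissingShell {y | (2 : ℝ) • b + L y ∈ V} u = L ⁻¹' kissingShell V ((2 : ℝ) • x c) := by
    intro b L u hu
    obtain ⟨c, hc⟩ := hu
    have hc' : (2 : ℝ) • x c = (2 : ℝ) • b + L u := hc
    have hLu : L u = (2 : ℝ) • x c - (2 : ℝ) • b := by rw [hc']; abel
    refine ⟨c, by rw [← L.norm_map u, hLu, norm_two_smul_sub_two_smul], ?_⟩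
    rw [kissingShell_moved, ← hc']
  by_cases hA : ∃ i₁ : Fin N, IsArrangedIn (kissingShell V ((2 : ℝ) • x i₁)) hcpKissingPattern ∧
      dist (x i₁) a ≤ 24 * M + 14
  · -- CASE A: the frame of an HCP-type ball `b` near the cube
    obtain ⟨i₁, hhcp, hb⟩ := hA
    set b := x i₁ with hb_def
    obtain ⟨L, s₀, hs₀, hS0⟩ := exists_hcp_frame hV hhcp
    have hW : IsUnitBallPacking {y | (2 : ℝ) • b + L y ∈ V} := hV.preimage _ L
    have hW0 : (0 : EuclideanSpace ℝ (Fin 3)) ∈ {y | (2 : ℝ) • b + L y ∈ V} := ⟨i₁, by simp [hb_def]⟩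
    have hcpW : ∀ u ∈ {y | (2 : ℝ) • b + L y ∈ V}, ‖u‖ ≤ 12 * (2 * (26 * M + 14)) + 28 →
        IsArrangedIn (kissingShell {y | (2 : ℝ) • b + L y ∈ V} u) fccKissingPattern ∨
          IsArrangedIn (kissingShell {y | (2 : ℝ) • b + L y ∈ V} u) hcpKissingPattern := by
      intro u hu hun
      obtain ⟨c, hcn, hSc⟩ := frameShell b L u hu
      rw [hSc]
      have hca : dist (x c) a ≤ 336 * M + 196 := by
        have := dist_triangle (x c) b a; rw [hcn] at hun; linarith
      exact (cpNear c hca).imp (fun h => h.preimage L) (fun h => h.preimage L)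
    obtain ⟨s, hs, hst⟩ := local_layerPackings_hcp hW hW0 hs₀ hS0 (R := 2 * (26 * M + 14)) hcpW
    refine ⟨L, b, s, hs, fun c hc => mem_stacking_of_frame (ρ := 26 * M + 14) hst ?_⟩
    have := dist_triangle (x c) a b
    have := dist_le_two_mul_of_mem_cube hc ha
    rw [dist_comm a b] at *; linarith
  · -- CASE B: all close-packed balls within `24M + 14` of `a` are FCC-type; an FCC frame at `a`
    push Not at hA
    have hfccNear : ∀ c : Fin N, dist (x c) a ≤ 24 * M + 14 →
        IsArrangedIn (kissingShell V ((2 : ℝ) • x c)) fccKissingPattern := fun c hc =>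
      (cpNear c (by linarith)).resolve_right fun h => absurd hc (not_le.2 (hA c h))
    have ha0 : IsArrangedIn (kissingShell V ((2 : ℝ) • a)) fccKissingPattern :=
      hfccNear i₀ (by rw [ha_def, dist_self]; positivity)
    obtain ⟨L, hH⟩ := exists_frame_of_isArrangedIn_fcc ha0
    have hW : IsUnitBallPacking {y | (2 : ℝ) • a + L y ∈ V} := hV.preimage _ L
    have hW0 : (0 : EuclideanSpace ℝ (Fin 3)) ∈ {y | (2 : ℝ) • a + L y ∈ V} := ⟨i₀, by simp [ha_def]⟩
    have hH' : hexagonSet ⊆ kissingShell {y | (2 : ℝ) • a + L y ∈ V} 0 := by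
      rw [kissingShell_moved, map_zero, add_zero]; exact hH
    have hfccW : ∀ u ∈ {y | (2 : ℝ) • a + L y ∈ V}, ‖u‖ ≤ 12 * (2 * (2 * M)) + 28 →
        IsArrangedIn (kissingShell {y | (2 : ℝ) • a + L y ∈ V} u) fccKissingPattern := by
      intro u hu hun
      obtain ⟨c, hcn, hSc⟩ := frameShell a L u hu
      rw [hSc]
      exact (hfccNear c (by rw [hcn] at hun; linarith)).preimage L
    obtain ⟨s, hs, hst⟩ := local_layerPackings_fcc hW hW0 hH' (R := 2 * (2 * M)) (by positivity) hfccW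
    exact ⟨L, a, s, hs, fun c hc => mem_stacking_of_frame (ρ := 2 * M) hst (dist_le_two_mul_of_mem_cube hc ha)⟩

/-! ## Ball form (appended): one stacking through every ball within `R` of a ball whose `(168R + 196)`-ball is defect-free -/

/-- **BALL RIGIDITY** (the radius form of `cubeRigidity_holds`, same proof with `2M ↦ R`): in every finite packing of
unit-diameter balls in `ℝ³`, if every ball within `168·R + 196` of the ball `a` has a close-packed first shell, then all balls
within `R` of `a` lie on ONE moved Barlow stacking.  (The margin must grow with `R`: two non-parallel twin families entering a
defect-free region far apart are both locally close-packed.)  For the grain-building step of `stub_textureBuild`. -/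
theorem ballRigidity {N : ℕ} {x : Fin N → EuclideanSpace ℝ (Fin 3)} (hx : IsUnitPacking x) (i₀ : Fin N) {R : ℝ}
    (hR : 0 ≤ R) (hcp : ∀ i : Fin N, dist (x i) (x i₀) ≤ 168 * R + 196 → IsClosePackedShell x i) :
    ∃ (L : EuclideanSpace ℝ (Fin 3) ≃ₗᵢ[ℝ] EuclideanSpace ℝ (Fin 3)) (s : EuclideanSpace ℝ (Fin 3)) (σ : ℤ → ℤ),
      IsHaggSeq σ ∧ ∀ i : Fin N, dist (x i) (x i₀) ≤ R → x i ∈ stacking L s σ := by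
  set a := x i₀ with ha_def
  set V : Set (EuclideanSpace ℝ (Fin 3)) := Set.range fun j => (2 : ℝ) • x j with hVdef
  have hV : IsUnitBallPacking V := isUnitBallPacking_range_two_smul hx
  have cpNear : ∀ c : Fin N, dist (x c) a ≤ 168 * R + 196 →
      IsArrangedIn (kissingShell V ((2 : ℝ) • x c)) fccKissingPattern ∨
        IsArrangedIn (kissingShell V ((2 : ℝ) • x c)) hcpKissingPattern := by
    intro c hc
    rw [hVdef, kissingShell_range_two_smul]
    exact hcp c hc
  have frameShell : ∀ (b : EuclideanSpace ℝ (Fin 3)) (L : EuclideanSpace ℝ (Fin 3) ≃ₗᵢ[ℝ] EuclideanSpace ℝ (Fin 3))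
      (u : EuclideanSpace ℝ (Fin 3)), u ∈ {y | (2 : ℝ) • b + L y ∈ V} →
      ∃ c : Fin N, ‖u‖ = 2 * dist (x c) b ∧
        kissingShell {y | (2 : ℝ) • b + L y ∈ V} u = L ⁻¹' kissingShell V ((2 : ℝ) • x c) := by
    intro b L u hu
    obtain ⟨c, hc⟩ := hu
    have hc' : (2 : ℝ) • x c = (2 : ℝ) • b + L u := hc
    have hLu : L u = (2 : ℝ) • x c - (2 : ℝ) • b := by rw [hc']; abel
    refine ⟨c, by rw [← L.norm_map u, hLu, norm_two_smul_sub_two_smul], ?_⟩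
    rw [kissingShell_moved, ← hc']
  by_cases hA : ∃ i₁ : Fin N, IsArrangedIn (kissingShell V ((2 : ℝ) • x i₁)) hcpKissingPattern ∧
      dist (x i₁) a ≤ 12 * R + 14
  · -- CASE A: the frame of an HCP-type ball `b` within `12R + 14`
    obtain ⟨i₁, hhcp, hb⟩ := hA
    set b := x i₁ with hb_def
    obtain ⟨L, s₀, hs₀, hS0⟩ := exists_hcp_frame hV hhcp
    have hW : IsUnitBallPacking {y | (2 : ℝ) • b + L y ∈ V} := hV.preimage _ L
    have hW0 : (0 : EuclideanSpace ℝ (Fin 3)) ∈ {y | (2 : ℝ) • b + L y ∈ V} := ⟨i₁, by simp [hb_def]⟩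
    have hcpW : ∀ u ∈ {y | (2 : ℝ) • b + L y ∈ V}, ‖u‖ ≤ 12 * (2 * (13 * R + 14)) + 28 →
        IsArrangedIn (kissingShell {y | (2 : ℝ) • b + L y ∈ V} u) fccKissingPattern ∨
          IsArrangedIn (kissingShell {y | (2 : ℝ) • b + L y ∈ V} u) hcpKissingPattern := by
      intro u hu hun
      obtain ⟨c, hcn, hSc⟩ := frameShell b L u hu
      rw [hSc]
      have hca : dist (x c) a ≤ 168 * R + 196 := by
        have := dist_triangle (x c) b a; rw [hcn] at hun; linarith
      exact (cpNear c hca).imp (fun h => h.preimage L) (fun h => h.preimage L)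
    obtain ⟨s, hs, hst⟩ := local_layerPackings_hcp hW hW0 hs₀ hS0 (R := 2 * (13 * R + 14)) hcpW
    refine ⟨L, b, s, hs, fun c hc => mem_stacking_of_frame (ρ := 13 * R + 14) hst ?_⟩
    have := dist_triangle (x c) a b
    rw [dist_comm a b] at *; linarith
  · -- CASE B: all close-packed balls within `12R + 14` of `a` are FCC-type
    push Not at hA
    have hfccNear : ∀ c : Fin N, dist (x c) a ≤ 12 * R + 14 →
        IsArrangedIn (kissingShell V ((2 : ℝ) • x c)) fccKissingPattern := fun c hc =>
      (cpNear c (by linarith)).resolve_right fun h => absurd hc (not_le.2 (hA c h))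
    have ha0 : IsArrangedIn (kissingShell V ((2 : ℝ) • a)) fccKissingPattern :=
      hfccNear i₀ (by rw [ha_def, dist_self]; positivity)
    obtain ⟨L, hH⟩ := exists_frame_of_isArrangedIn_fcc ha0
    have hW : IsUnitBallPacking {y | (2 : ℝ) • a + L y ∈ V} := hV.preimage _ L
    have hW0 : (0 : EuclideanSpace ℝ (Fin 3)) ∈ {y | (2 : ℝ) • a + L y ∈ V} := ⟨i₀, by simp [ha_def]⟩
    have hH' : hexagonSet ⊆ kissingShell {y | (2 : ℝ) • a + L y ∈ V} 0 := by
      rw [kissingShell_moved, map_zero, add_zero]; exact hH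
    have hfccW : ∀ u ∈ {y | (2 : ℝ) • a + L y ∈ V}, ‖u‖ ≤ 12 * (2 * R) + 28 →
        IsArrangedIn (kissingShell {y | (2 : ℝ) • a + L y ∈ V} u) fccKissingPattern := by
      intro u hu hun
      obtain ⟨c, hcn, hSc⟩ := frameShell a L u hu
      rw [hSc]
      exact (hfccNear c (by rw [hcn] at hun; linarith)).preimage L
    obtain ⟨s, hs, hst⟩ := local_layerPackings_fcc hW hW0 hH' (R := 2 * R) (by positivity) hfccW
    exact ⟨L, a, s, hs, fun c hc => mem_stacking_of_frame (ρ := R) hst hc⟩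

end Summit.Ventures.Crystal3D.Theorems

namespace Summit.Ventures.Crystal3D.Cruxes.TextureLiminf.TexShadow

/-- **The skeleton's stub `stub_cubeRigidity : CubeRigidity`, BY NAME** (TexShadow v6.12 §4): the tree theorem
`Summit.Ventures.Crystal3D.Theorems.cubeRigidity_holds`. -/
theorem stub_cubeRigidity : CubeRigidity :=
  Summit.Ventures.Crystal3D.Theorems.cubeRigidity_holds

/-- **The registered stub `stub_resolution : L12Local → BarlowResolution`, BY NAME** (TexShadow v6.3 registered / v6.12 derived):
the counting half `barlowResolution_of_cubeRigidity` (`…ResolutionOfRigidity`) fed with `stub_cubeRigidity`. -/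
theorem stub_resolution : L12Local → BarlowResolution :=
  fun hL => Summit.Ventures.Crystal3D.Theorems.barlowResolution_of_cubeRigidity hL stub_cubeRigidity

end Summit.Ventures.Crystal3D.Cruxes.TextureLiminf.TexShadow

end
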